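import Literature.MathematicalPhysics.QuantumFieldTheory.Balaban1983to89.Beta.KKTFluctuationKernel

/-!
# `Balaban1983to89.Beta.ScalarBlockKKT` — THE SCALAR BLOCK-AVERAGE-CONSTRAINED LAPLACIAN ON `ℤ^{d+1}`: Bloch fibres,
nonsingularity at every real momentum, the fundamental solution, and its GREEN KERNEL (the U = 1 scalar / ghost-type
propagator of the β sub-cell's one-shot block step) with decay at fixed `N` (β sub-cell row BETA-an2, unit
`b2b-balaban-beta-an2` gen 6; AN2.md §14 brick (G′))

HONEST FRAMING (cell `pub-balaban`, verbatim): discharging `BetaPertH` makes Bałaban's UV stability UNCONDITIONAL — a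
real constructive-QFT result; it is NOT the continuum limit and NOT the Clay problem.  This module is [folklore] lattice
linear algebra on landed machinery; it asserts NOTHING about Bałaban's papers, contains no `def … : Prop` fact, cites
no published theorem as a hypothesis, and is NOT summit progress.  ABSOLUTE RULE honoured: nothing is cited; everything
is proved.

## What is here (the scalar companion of `BlochFibreMatrix` + `KKTFluctuationKernel`)

The SCALAR KKT system on the fine lattice `ℤ^{d+1}` with blocks of side `N`:

  (ELₛ)  `codiff₁ (dz λ) x = ω (quo N x) + F x`      (`codiff₁ ∘ dz = −Δ`; `ω` a coarse multiplier, `F` a force),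
  (Mₛ)   `blockSum N λ y = c y`                       (prescribed block sums),

i.e. the Lagrange (KKT) system of `λ ↦ ½|dz λ|² − ⟨F, λ⟩` under the block-sum constraints.  In block coordinates
(`IdxS d N := TorusSite d N ⊕ Unit`: the box values of `λ` and the value of `ω` at the block) it is a finite-range
block-Toeplitz system `Σ_{a ∈ [−3,3]^{d+1}} Lₐ U(y + a)` (`cfgFunS_shiftCfgS_eq_sum`) exactly as the vector system of
`BlochFibreMatrix`, and:

1. `eq_zero_of_fibreLinS_eq_zero` / `det_fibreMatrixS_ne_zero`: every UNITARY Bloch fibre is nonsingular — a Bloch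
   solution of the homogeneous system has `codiff₁ (dz λ)` constant on the box and zero box sum, so
   `⟨λ, codiff₁ (dz λ)⟩_box = 0 = ‖dz λ‖²_box` (`BlochFibreUniqueness.ip0_eq_zero_of_boxConst`, `ip0_lapN_right`), `λ` is
   discrete-harmonic and Bloch with zero box sum, hence `0` (`eq_zero_of_lap_of_bsum`), and then `ω = 0`.
2. `det_trigPolySymbolS_ne_zero`, `invKernelS_decay_l1`, `fundCfgS`, `cfgFunS_fundCfgS`: junction with the generic engine
   `FibreInverseDecay` (nonsingular real fibres ⇒ exponentially decaying two-sided fundamental solution).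
3. THE GREEN KERNEL with a unit force at a fine site: `gS z₀ := Re λ`-part of the fundamental configuration with source on
   the EL row `inl z₀`; identities `gS_EL` (`codiff₁ (dz (gS z₀)) x = wS z₀ (quo N x) + δ_{x, repZ z₀}`), `gS_M`
   (`blockSum N (gS z₀) y = 0`: a FLUCTUATION field); decay at FIXED `N` (`decay_gS`, `decay_wS`; witnesses N-dependent,
   no uniformity claimed); arbitrary source site by block translation TAKEN AS THE DEFINITION `Gs x x'`, `Ws y x'` with
   `Gs_EL`, `Gs_M` and `decay_Gs : |Gs x x'| ≤ C e^{−δ |x − x'|₁}`.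

NOT here (next bricks, AN2.md §14.4): symmetry / positivity of `Gs` (energy identity) and tempered uniqueness
(`FibreLiouville`), both routine copies of `KKTFluctuationEnergy` / `KKTFluctuationUnique`; the identification of this
kernel with the printed scalar operators `G′`, `𝒮` of [Balaban1985BackgroundPropagators] §3 (a markdown READING in
AN2.md, never cited); any `N`-uniform estimate.
-/

namespace Literature.MathematicalPhysics.QuantumFieldTheory.Balaban1983to89.Beta.ScalarBlockKKT

noncomputable section

open scoped ComplexConjugate
open Literature.Probability.LatticeModels (TorusSite Torus.proj Torus.proj_apply)
open AffineAveraging (Form0 Form1 unitVec unitVec_apply dz codiff₁ box toSite blockSum)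
open AffineReproduction (IsBlockConst)
open LatticeForm (IsBloch repZ quo proj_repZ proj_add_zsmul)
open BlochFibreUniqueness (quo_add_zsmul quo_repZ isBloch_iff isBloch_one_iff' isBloch_sub isBloch_dz isBloch_lapN
  isBloch_blockSum isBloch_eq_zero_of_box bsum ip0 ip1 ip0_eq_zero_of_boxConst ip0_lapN_right ip1_self_eq_zero_iff
  eq_zero_of_lap_of_bsum blockSum_zero_eq_bsum codiff₁_dz_eq_neg_lap)
open BlochFibreMatrix (stencil mem_stencil zero_mem_stencil quo_mem_stencil quo_repZ_add_mem repZ_nonneg repZ_lt repZ_zero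
  Agree agree_dz agree_codiff₁ delta blochChar norm_blochChar_real dz_translate codiff₁_translate blockSum_translate
  eq_repZ_add_zsmul_quo dz_add' dz_smul' codiff₁_add' codiff₁_smul' blockSum_add' blockSum_smul')
open FibreInverseDecay (trigPolySymbol invKernel)
open Literature.MathematicalPhysics.QuantumFieldTheory.Balaban1983to89.B4Strip (ofRealVec)
open Literature.MathematicalPhysics.QuantumFieldTheory.Balaban1983to89.B4ContourShift (BZ)
open KernelSpecInstance (re0 re0_apply re1 re1_apply re1_dz re0_codiff₁ exp_quo_le l1_le_l1_quo)
open KKTFluctuationKernel (l1_sub_le l1_repZ_le eq_repZ_iff blockSum_shift)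
open B12Sec2to5 (l1 Decay510)

variable {d N : ℕ}

/-! ## §1 Index type, configurations, fields, residual -/

/-- Box coordinates of one block of the scalar system: the box values of `λ` and the block's multiplier `ω`. [folklore] -/
abbrev IdxS (d N : ℕ) : Type := TorusSite d N ⊕ Unit

/-- A configuration: box data on every block. [folklore] -/
abbrev CfgS (d N : ℕ) : Type := AffineAveraging.Site d → IdxS d N → ℂ

/-- The fine scalar field of a configuration: `λ x = U (quo N x) (proj N x)`. [folklore] -/
def cfgL (U : CfgS d N) : Form0 d ℂ := fun x => U (quo N x) (Sum.inl (Torus.proj N x))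

/-- The coarse multiplier of a configuration: `ω y = U y ()`. [folklore] -/
def cfgW (U : CfgS d N) : Form0 d ℂ := fun y => U y (Sum.inr ())

/-- The tensor configuration `c ⊗ v`. [folklore] -/
def tensS (c : AffineAveraging.Site d → ℂ) (v : IdxS d N → ℂ) : CfgS d N := fun q i => c q * v i

/-- The adjoint of the block sum applied to a coarse field: `x ↦ ω (quo N x)`. [folklore] -/
def bsAdj {R : Type*} (N : ℕ) (ω : Form0 d R) : Form0 d R := fun x => ω (quo N x)

/-- Unfolding `bsAdj`. [folklore] -/
@[simp] theorem bsAdj_apply {R : Type*} (N : ℕ) (ω : Form0 d R) (x : AffineAveraging.Site d) :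
    bsAdj N ω x = ω (quo N x) := rfl

/-- `cfgL` is additive. [folklore] -/
theorem cfgL_add (U V : CfgS d N) : cfgL (U + V) = cfgL U + cfgL V := by
  funext x; simp [cfgL]

/-- `cfgL` is homogeneous. [folklore] -/
theorem cfgL_smul (a : ℂ) (U : CfgS d N) : cfgL (a • U) = a • cfgL U := by
  funext x; simp [cfgL]

/-- `cfgW` is additive. [folklore] -/
theorem cfgW_add (U V : CfgS d N) : cfgW (U + V) = cfgW U + cfgW V := by
  funext x; simp [cfgW]

/-- `cfgW` is homogeneous. [folklore] -/
theorem cfgW_smul (a : ℂ) (U : CfgS d N) : cfgW (a • U) = a • cfgW U := by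
  funext x; simp [cfgW]

/-- `tensS` is additive in the box data. [folklore] -/
theorem tensS_add_right (c : AffineAveraging.Site d → ℂ) (v w : IdxS d N → ℂ) :
    tensS c (v + w) = tensS c v + tensS c w := by
  funext q i; simp [tensS, mul_add]

/-- `tensS` is homogeneous in the box data. [folklore] -/
theorem tensS_smul_right (c : AffineAveraging.Site d → ℂ) (a : ℂ) (v : IdxS d N → ℂ) :
    tensS c (a • v) = a • tensS c v := by
  funext q i; simp [tensS]; ring

/-- `tensS` is homogeneous in the coefficient function. [folklore] -/
theorem tensS_smul_left (a : ℂ) (c : AffineAveraging.Site d → ℂ) (v : IdxS d N → ℂ) :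
    tensS (a • c) v = a • tensS c v := by
  funext q i; simp [tensS]; ring

/-- THE RESIDUAL VECTOR of the homogeneous scalar system on the box of the origin: EL rows
`codiff₁ (dz λ) (repZ z) − ω 0`, and the M row `blockSum N λ 0`. [folklore] -/
def residS [NeZero N] (lam ω : Form0 d ℂ) : IdxS d N → ℂ := fun i =>
  match i with
  | Sum.inl z => codiff₁ (dz lam) (repZ z) - ω 0
  | Sum.inr _ => blockSum N lam 0

section Resid

variable [NeZero N]

/-- EL rows of the residual. [folklore] -/
@[simp] theorem residS_inl (lam ω : Form0 d ℂ) (z : TorusSite d N) :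
    residS lam ω (Sum.inl z) = codiff₁ (dz lam) (repZ z) - ω 0 := rfl

/-- The M row of the residual. [folklore] -/
@[simp] theorem residS_inr (lam ω : Form0 d ℂ) (u : Unit) :
    residS (N := N) lam ω (Sum.inr u) = blockSum N lam 0 := rfl

/-- The residual is additive. [folklore] -/
theorem residS_add (lam lam' ω ω' : Form0 d ℂ) :
    residS (N := N) (lam + lam') (ω + ω') = residS lam ω + residS lam' ω' := by
  funext i
  rcases i with z | u
  · simp only [Pi.add_apply, residS_inl, dz_add', codiff₁_add']; ring
  · simp only [Pi.add_apply, residS_inr, blockSum_add']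

/-- The residual is homogeneous. [folklore] -/
theorem residS_smul (a : ℂ) (lam ω : Form0 d ℂ) :
    residS (N := N) (a • lam) (a • ω) = a • residS lam ω := by
  funext i
  rcases i with z | u
  · simp only [Pi.smul_apply, smul_eq_mul, residS_inl, dz_smul', codiff₁_smul']; ring
  · simp only [Pi.smul_apply, smul_eq_mul, residS_inr, blockSum_smul']

/-- THE RESIDUAL OF A CONFIGURATION on the box of the origin. [folklore] -/
def cfgFunS (U : CfgS d N) : IdxS d N → ℂ := residS (cfgL U) (cfgW U)

/-- Additivity. [folklore] -/
theorem cfgFunS_add (U V : CfgS d N) : cfgFunS (U + V) = cfgFunS U + cfgFunS V := by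
  simp only [cfgFunS, cfgL_add, cfgW_add, residS_add]

/-- Homogeneity. [folklore] -/
theorem cfgFunS_smul (a : ℂ) (U : CfgS d N) : cfgFunS (a • U) = a • cfgFunS U := by
  simp only [cfgFunS, cfgL_smul, cfgW_smul, residS_smul]

/-- The zero configuration has zero residual. [folklore] -/
theorem cfgFunS_zero : cfgFunS (0 : CfgS d N) = 0 := by
  have h := cfgFunS_smul (N := N) (d := d) (0 : ℂ) 0
  rwa [zero_smul, zero_smul] at h

/-- Residual of a finite sum of configurations. [folklore] -/
theorem cfgFunS_finset_sum {ι : Type*} (s : Finset ι) (W : ι → CfgS d N) :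
    cfgFunS (∑ i ∈ s, W i) = ∑ i ∈ s, cfgFunS (W i) := by
  classical
  induction s using Finset.induction_on with
  | empty => simp only [Finset.sum_empty]; exact cfgFunS_zero
  | insert j s hj ih => rw [Finset.sum_insert hj, Finset.sum_insert hj, cfgFunS_add, ih]

end Resid

/-! ## §2 The fibre map and its matrix -/

section Fibre

variable [NeZero N]

/-- The fibre map on box coordinates. [folklore] -/
def fibreFunS (c : AffineAveraging.Site d → ℂ) (v : IdxS d N → ℂ) : IdxS d N → ℂ := cfgFunS (tensS c v)

/-- Additivity in the box data. [folklore] -/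
theorem fibreFunS_add_v (c : AffineAveraging.Site d → ℂ) (v w : IdxS d N → ℂ) :
    fibreFunS c (v + w) = fibreFunS c v + fibreFunS c w := by
  simp only [fibreFunS, tensS_add_right, cfgFunS_add]

/-- Homogeneity in the box data. [folklore] -/
theorem fibreFunS_smul_v (c : AffineAveraging.Site d → ℂ) (a : ℂ) (v : IdxS d N → ℂ) :
    fibreFunS c (a • v) = a • fibreFunS c v := by
  simp only [fibreFunS, tensS_smul_right, cfgFunS_smul]

/-- THE FIBRE MAP as a linear endomorphism. [folklore] -/
def fibreLinS (c : AffineAveraging.Site d → ℂ) : (IdxS d N → ℂ) →ₗ[ℂ] (IdxS d N → ℂ) where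
  toFun := fibreFunS c
  map_add' := fibreFunS_add_v c
  map_smul' a v := by simp only [RingHom.id_apply]; exact fibreFunS_smul_v c a v

/-- Unfolding. [folklore] -/
@[simp] theorem fibreLinS_apply (c : AffineAveraging.Site d → ℂ) (v : IdxS d N → ℂ) :
    fibreLinS c v = fibreFunS c v := rfl

/-- THE FIBRE MATRIX (square by construction). [folklore] -/
def fibreMatrixS (c : AffineAveraging.Site d → ℂ) : Matrix (IdxS d N) (IdxS d N) ℂ :=
  LinearMap.toMatrix' (fibreLinS c)

/-- `fibreMatrixS c` acts as the fibre map. [folklore] -/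
theorem fibreMatrixS_mulVec (c : AffineAveraging.Site d → ℂ) (v : IdxS d N → ℂ) :
    (fibreMatrixS c).mulVec v = fibreFunS c v := by
  rw [fibreMatrixS, LinearMap.toMatrix'_mulVec, fibreLinS_apply]

end Fibre

/-! ## §3 Unitary characters: INJECTIVITY of every unitary fibre (the scalar Bloch-fibre uniqueness) -/

section Character

variable [NeZero N] (χ : AddChar (AffineAveraging.Site d) ℂ)

/-- The fine field of `χ ⊗ v` is `χ`-Bloch w.r.t. `N•ℤ^d`. [folklore] -/
theorem isBloch_cfgL (v : IdxS d N → ℂ) : IsBloch N (⇑χ) (cfgL (tensS (⇑χ) v)) := by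
  rw [isBloch_iff]; intro x a
  simp only [cfgL, tensS, quo_add_zsmul, proj_add_zsmul, AddChar.map_add_eq_mul]; ring

omit [NeZero N] in
/-- The multiplier of `χ ⊗ v` is `χ`-Bloch w.r.t. `ℤ^d`. [folklore] -/
theorem isBloch_cfgW (v : IdxS d N → ℂ) : IsBloch 1 (⇑χ) (cfgW (tensS (⇑χ) v)) := by
  rw [isBloch_one_iff']; intro y a
  simp only [cfgW, tensS, AddChar.map_add_eq_mul]; ring

/-- `bsAdj N` of a `1`-Bloch coarse field is `N`-Bloch. [folklore] -/
theorem isBloch_bsAdj {χ' : AffineAveraging.Site d → ℂ} {ω : Form0 d ℂ} (hω : IsBloch 1 χ' ω) :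
    IsBloch N χ' (bsAdj N ω) := by
  rw [isBloch_iff]; intro x a
  simp only [bsAdj_apply, quo_add_zsmul]
  exact (isBloch_one_iff'.1 hω) _ _

/-- Box values of the fine field of `χ ⊗ v`. [folklore] -/
theorem cfgL_repZ (v : IdxS d N → ℂ) (z : TorusSite d N) : cfgL (tensS (⇑χ) v) (repZ z) = v (Sum.inl z) := by
  simp only [cfgL, tensS, quo_repZ, proj_repZ, AddChar.map_zero_eq_one, one_mul]

omit [NeZero N] in
/-- The multiplier of `χ ⊗ v` at the origin. [folklore] -/
theorem cfgW_zero (v : IdxS d N → ℂ) : cfgW (tensS (⇑χ) v) 0 = v (Sum.inr ()) := by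
  simp only [cfgW, tensS, AddChar.map_zero_eq_one, one_mul]

/-- THE SYSTEM READ BACK ON `ℤ^d`: if `fibreLinS χ v = rhs` with `rhs` vanishing on the EL rows, the Bloch fields of
`χ ⊗ v` satisfy (ELₛ) with zero force EVERYWHERE and have block sums `χ y · rhs (M row)`. [folklore] -/
theorem solves_of_fibreLinS_eq {v rhs : IdxS d N → ℂ} (h : fibreLinS (⇑χ) v = rhs)
    (hEL0 : ∀ z, rhs (Sum.inl z) = 0) :
    (∀ x, codiff₁ (dz (cfgL (tensS (⇑χ) v))) x = cfgW (tensS (⇑χ) v) (quo N x))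
    ∧ (∀ y, blockSum N (cfgL (tensS (⇑χ) v)) y = χ y * rhs (Sum.inr ())) := by
  have hres : ∀ i, residS (cfgL (tensS (⇑χ) v)) (cfgW (tensS (⇑χ) v)) i = rhs i := fun i => by
    have := congrArg (fun f => f i) h
    simpa only [fibreLinS_apply, fibreFunS, cfgFunS] using this
  set lam := cfgL (tensS (⇑χ) v) with hlamdef
  set ω := cfgW (tensS (⇑χ) v) with hωdef
  have hlam : IsBloch N (⇑χ) lam := isBloch_cfgL χ v
  have hω : IsBloch 1 (⇑χ) ω := isBloch_cfgW χ v
  refine ⟨?_, ?_⟩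
  · have hR : IsBloch N (⇑χ) (fun x => codiff₁ (dz lam) x - bsAdj N ω x) :=
      isBloch_sub (isBloch_lapN hlam) (isBloch_bsAdj hω)
    have h0 := isBloch_eq_zero_of_box hR (fun z => by
      have := hres (Sum.inl z)
      rw [residS_inl, hEL0] at this
      simp only [bsAdj_apply, quo_repZ]
      exact this)
    intro x
    have := congrArg (fun f => f x) h0
    simp only [Pi.zero_apply, bsAdj_apply] at this
    exact sub_eq_zero.1 this
  · have hM0 : blockSum N lam 0 = rhs (Sum.inr ()) := by
      have := hres (Sum.inr ()); rwa [residS_inr] at this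
    intro y
    have h1 := (isBloch_one_iff'.1 (isBloch_blockSum hlam)) 0 y
    rw [zero_add, hM0] at h1
    exact h1

/-- **INJECTIVITY OF EVERY UNITARY FIBRE** (the scalar Bloch-fibre uniqueness): for a multiplicative unitary `χ`, a
box-coordinate vector in the kernel of the fibre map is zero.  Proof: `codiff₁ (dz λ)` is constant on the box (`= ω 0`)
and `λ` has zero box sum, so `⟨λ, codiff₁ (dz λ)⟩_box = 0`, i.e. `‖dz λ‖²_box = 0`; hence `λ` is discrete-harmonic,
Bloch, of zero box sum, hence `0`; then `ω 0 = codiff₁ (dz 0) 0 = 0`. [folklore] -/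
theorem eq_zero_of_fibreLinS_eq_zero (hχ : ∀ a, ‖χ a‖ = 1) {v : IdxS d N → ℂ} (h : fibreLinS (⇑χ) v = 0) :
    v = 0 := by
  obtain ⟨hEL, hM⟩ := solves_of_fibreLinS_eq χ (v := v) (rhs := 0) h (fun _ => rfl)
  set lam := cfgL (tensS (⇑χ) v) with hlamdef
  set ω := cfgW (tensS (⇑χ) v) with hωdef
  have hlam : IsBloch N (⇑χ) lam := isBloch_cfgL χ v
  have hbsum : bsum N lam = 0 := by
    rw [← blockSum_zero_eq_bsum]; have := hM 0; simpa using this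
  have hq0 : quo N (0 : AffineAveraging.Site d) = 0 := by
    have := quo_repZ (N := N) (0 : TorusSite d N); rwa [repZ_zero] at this
  have hconst : ∀ z : TorusSite d N, codiff₁ (dz lam) (repZ z) = codiff₁ (dz lam) 0 := by
    intro z; rw [hEL, hEL, quo_repZ, hq0]
  have hip : ip0 N lam (codiff₁ (dz lam)) = 0 := ip0_eq_zero_of_boxConst hbsum hconst
  rw [ip0_lapN_right hlam hlam hχ, ip1_self_eq_zero_iff] at hip
  have hdz : dz lam = 0 := by
    funext κ
    exact isBloch_eq_zero_of_box (isBloch_dz hlam κ) (fun z => hip κ z)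
  have hlap : ∀ x, LatticeForm.lap lam x = 0 := by
    intro x
    have h1 := codiff₁_dz_eq_neg_lap lam x
    rw [hdz] at h1
    have h2 : codiff₁ (0 : Form1 d ℂ) x = 0 := by simp [codiff₁]
    rw [h2] at h1
    exact neg_eq_zero.1 h1.symm
  have hlam0 : lam = 0 := eq_zero_of_lap_of_bsum hχ hlam hlap hbsum
  have hω0 : ω 0 = 0 := by
    have h1 := hEL 0
    have h2 : codiff₁ (dz lam) 0 = 0 := by
      rw [hdz]; simp [codiff₁]
    rw [h2, hq0] at h1
    exact h1.symm
  funext i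
  rcases i with z | u
  · rw [← cfgL_repZ χ v z]
    show lam (repZ z) = 0
    rw [hlam0]; rfl
  · rw [show u = () from rfl, ← cfgW_zero χ v]
    exact hω0

/-- The fibre map of a unitary character is injective. [folklore] -/
theorem fibreLinS_injective (hχ : ∀ a, ‖χ a‖ = 1) : Function.Injective (fibreLinS (N := N) (⇑χ)) :=
  (injective_iff_map_eq_zero _).2 fun _ hv => eq_zero_of_fibreLinS_eq_zero χ hχ hv

/-- … hence the fibre matrix is invertible. [folklore] -/
theorem isUnit_fibreMatrixS (hχ : ∀ a, ‖χ a‖ = 1) : IsUnit (fibreMatrixS (N := N) (⇑χ)) := by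
  rw [← Matrix.mulVec_injective_iff_isUnit]
  intro v w hvw
  apply fibreLinS_injective χ hχ
  simpa only [fibreLinS_apply, fibreMatrixS_mulVec] using hvw

/-- … and has non-zero determinant. [folklore] -/
theorem det_fibreMatrixS_ne_zero (hχ : ∀ a, ‖χ a‖ = 1) : (fibreMatrixS (N := N) (⇑χ)).det ≠ 0 :=
  isUnit_iff_ne_zero.1 ((Matrix.isUnit_iff_isUnit_det _).1 (isUnit_fibreMatrixS χ hχ))

end Character

/-! ## §4 Locality and the block operator -/

section Locality

variable [NeZero N] {U U' : CfgS d N}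

/-- Configurations agreeing on the stencil cube give fine fields agreeing on radius-3 cubes around box points. [folklore] -/
theorem agree_cfgL (h : ∀ q ∈ stencil d, U q = U' q) (z : TorusSite d N) :
    Agree 3 (cfgL U) (cfgL U') (repZ z) := by
  intro t ht
  simp only [cfgL]
  rw [h _ (quo_repZ_add_mem z (fun j => by have := ht j; push_cast at this; exact this))]

/-- EL entry, Laplacian part. [folklore] -/
theorem lapN_congr (h : ∀ q ∈ stencil d, U q = U' q) (z : TorusSite d N) :
    codiff₁ (dz (cfgL U)) (repZ z) = codiff₁ (dz (cfgL U')) (repZ z) := by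
  have h3 : Agree (1 + 1 + 1) (cfgL U) (cfgL U') (repZ z) := agree_cfgL h z
  have h2 : ∀ κ, Agree (1 + 1) (dz (cfgL U) κ) (dz (cfgL U') κ) (repZ z) := fun κ => agree_dz h3 κ
  exact ((agree_codiff₁ h2).mono).self

omit [NeZero N] in
/-- EL entry, multiplier part. [folklore] -/
theorem cfgW_zero_congr (h : ∀ q ∈ stencil d, U q = U' q) : cfgW U 0 = cfgW U' 0 := by
  simp only [cfgW]; rw [h 0 zero_mem_stencil]

/-- M entry. [folklore] -/
theorem blockSumS_congr (h : ∀ q ∈ stencil d, U q = U' q) :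
    blockSum N (cfgL U) 0 = blockSum N (cfgL U') 0 := by
  have hN : (0 : ℤ) < N := by exact_mod_cast Nat.pos_of_ne_zero (NeZero.ne N)
  simp only [blockSum, smul_zero, zero_add]
  refine Finset.sum_congr rfl (fun b hb => ?_)
  simp only [cfgL]
  rw [h _ (quo_mem_stencil ?_ ?_)]
  · intro j
    simp only [toSite]
    have h0 : (0 : ℤ) ≤ (b j : ℤ) := Int.natCast_nonneg _
    linarith [hN]
  · intro j
    have hbj : b j < N := Finset.mem_range.1 (Fintype.mem_piFinset.1 hb j)
    simp only [toSite]
    have : ((b j : ℕ) : ℤ) < N := by exact_mod_cast hbj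
    linarith [hN]

/-- **LOCALITY**: the residual on the box of the origin reads the configuration on the stencil cube only. [folklore] -/
theorem cfgFunS_congr (h : ∀ q ∈ stencil d, U q = U' q) : cfgFunS U = cfgFunS U' := by
  funext i
  rcases i with z | u
  · simp only [cfgFunS, residS_inl]
    rw [lapN_congr h, cfgW_zero_congr h]
  · simp only [cfgFunS, residS_inr]
    exact blockSumS_congr h

end Locality

section Symbol

variable [NeZero N]

/-- The matrix of the one-offset piece `q`. [folklore] -/
def pieceMatrixS (q : AffineAveraging.Site d) : Matrix (IdxS d N) (IdxS d N) ℂ := fibreMatrixS (delta q)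

omit [NeZero N] in
/-- A configuration agrees on the stencil cube with its stencil part. [folklore] -/
theorem cfgS_eq_sum_tens_on_stencil (U : CfgS d N) :
    ∀ q ∈ stencil d, U q = (∑ a ∈ stencil d, tensS (delta a) (U a)) q := by
  intro q hq
  funext i
  rw [Finset.sum_apply, Finset.sum_apply]
  simp only [tensS, delta]
  rw [Finset.sum_eq_single_of_mem q hq (fun a _ ha => by rw [if_neg (Ne.symm ha), zero_mul])]
  rw [if_pos rfl, one_mul]

/-- **THE BLOCK OPERATOR**: `cfgFunS U = Σ_{q ∈ [−3,3]^d} L_q (U q)`. [folklore] -/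
theorem cfgFunS_eq_sum (U : CfgS d N) : cfgFunS U = ∑ q ∈ stencil d, (pieceMatrixS q).mulVec (U q) := by
  rw [cfgFunS_congr (cfgS_eq_sum_tens_on_stencil U), cfgFunS_finset_sum]
  refine Finset.sum_congr rfl (fun q _ => ?_)
  show fibreFunS (delta q) (U q) = (pieceMatrixS q).mulVec (U q)
  rw [pieceMatrixS, fibreMatrixS_mulVec]

/-- Symbol form of the fibre map. [folklore] -/
theorem fibreFunS_eq_sum (c : AffineAveraging.Site d → ℂ) (v : IdxS d N → ℂ) :
    fibreFunS c v = ∑ q ∈ stencil d, c q • (pieceMatrixS q).mulVec v := by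
  rw [fibreFunS, cfgFunS_eq_sum]
  refine Finset.sum_congr rfl (fun q _ => ?_)
  rw [show tensS c v q = c q • v from by funext i; simp [tensS, smul_eq_mul], Matrix.mulVec_smul]

/-- Symbol form of the fibre matrix: `𝕃(c) = Σ_q c q • L_q`. [folklore] -/
theorem fibreMatrixS_eq_sum (c : AffineAveraging.Site d → ℂ) :
    fibreMatrixS (N := N) c = ∑ q ∈ stencil d, c q • pieceMatrixS q := by
  apply Matrix.toLin'.injective
  apply LinearMap.ext; intro v
  rw [Matrix.toLin'_apply, Matrix.toLin'_apply, fibreMatrixS_mulVec, fibreFunS_eq_sum, Matrix.sum_mulVec]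
  refine Finset.sum_congr rfl (fun q _ => ?_)
  rw [Matrix.smul_mulVec]

/-- The trigonometric-polynomial symbol. [folklore] -/
theorem fibreMatrixS_blochChar (p : Fin d → ℂ) :
    fibreMatrixS (N := N) (⇑(blochChar p)) = ∑ q ∈ stencil d, Complex.exp (Complex.I * ∑ μ, p μ * (q μ : ℂ)) • pieceMatrixS q :=
  fibreMatrixS_eq_sum _

/-- Non-singularity on the real torus. [folklore] -/
theorem det_fibreMatrixS_blochChar_ne_zero (p : Fin d → ℝ) :
    (fibreMatrixS (N := N) (⇑(blochChar (fun μ => (p μ : ℂ))))).det ≠ 0 :=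
  det_fibreMatrixS_ne_zero _ (norm_blochChar_real p)

end Symbol

/-! ## §5 Translation covariance -/

section Translate

variable [NeZero N]

/-- The configuration seen from block `y`. [folklore] -/
def shiftCfgS (U : CfgS d N) (y : AffineAveraging.Site d) : CfgS d N := fun q => U (y + q)

/-- The fine field of the shifted configuration is the `N•y`-translate. [folklore] -/
theorem cfgL_shiftCfgS (U : CfgS d N) (y x : AffineAveraging.Site d) :
    cfgL (shiftCfgS U y) x = cfgL U (x + (N : ℤ) • y) := by
  simp only [cfgL, shiftCfgS, quo_add_zsmul, proj_add_zsmul]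
  rw [add_comm (quo N x) y]

omit [NeZero N] in
/-- The multiplier of the shifted configuration is the `y`-translate. [folklore] -/
theorem cfgW_shiftCfgS (U : CfgS d N) (y q : AffineAveraging.Site d) :
    cfgW (shiftCfgS U y) q = cfgW U (q + y) := by
  simp only [cfgW, shiftCfgS]; rw [add_comm q y]

/-- EL Laplacian term of a translate. [folklore] -/
theorem lapN_translate (f : Form0 d ℂ) (w x : AffineAveraging.Site d) :
    codiff₁ (dz (fun x => f (x + w))) x = codiff₁ (dz f) (x + w) := by
  simp only [dz_translate, codiff₁_translate]

/-- **THE BLOCK OPERATOR AT BLOCK `y`**: `cfgFunS (shiftCfgS U y) = Σ_a L_a (U (y + a))`. [folklore] -/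
theorem cfgFunS_shiftCfgS_eq_sum (U : CfgS d N) (y : AffineAveraging.Site d) :
    cfgFunS (shiftCfgS U y) = ∑ a ∈ stencil d, (pieceMatrixS a).mulVec (U (y + a)) :=
  cfgFunS_eq_sum _

/-- EL rows at block `y`. [folklore] -/
theorem cfgFunS_shiftCfgS_inl (U : CfgS d N) (y : AffineAveraging.Site d) (z : TorusSite d N) :
    cfgFunS (shiftCfgS U y) (Sum.inl z)
      = codiff₁ (dz (cfgL U)) (repZ z + (N : ℤ) • y) - cfgW U y := by
  have hL : cfgL (shiftCfgS U y) = fun x => cfgL U (x + (N : ℤ) • y) := by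
    funext x; exact cfgL_shiftCfgS U y x
  simp only [cfgFunS, residS_inl]
  rw [hL, lapN_translate, cfgW_shiftCfgS, zero_add]

/-- The M row at block `y`. [folklore] -/
theorem cfgFunS_shiftCfgS_inr (U : CfgS d N) (y : AffineAveraging.Site d) (u : Unit) :
    cfgFunS (shiftCfgS U y) (Sum.inr u) = blockSum N (cfgL U) y := by
  have hL : cfgL (shiftCfgS U y) = fun x => cfgL U (x + (N : ℤ) • y) := by
    funext x; exact cfgL_shiftCfgS U y x
  simp only [cfgFunS, residS_inr]
  rw [hL, blockSum_translate]

end Translate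

/-! ## §6 Junction with `FibreInverseDecay` (dimension `d + 1`): the fundamental configuration -/

section Junction

variable [NeZero N]

/-- `fibreMatrixS (blochChar p)` IS `trigPolySymbol (stencil (d+1)) pieceMatrixS p`. [folklore] -/
theorem fibreMatrixS_blochChar_eq_trigPolySymbol (p : Fin (d + 1) → ℂ) :
    fibreMatrixS (N := N) (⇑(blochChar p)) = trigPolySymbol (stencil (d + 1)) (pieceMatrixS (N := N)) p := by
  rw [fibreMatrixS_blochChar]
  simp only [FibreInverseDecay.trigPolySymbol, FibreInverseDecay.cphase]

/-- The scalar symbol is non-singular at every real momentum. [folklore] -/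
theorem det_trigPolySymbolS_ne_zero (s : Fin (d + 1) → ℝ) :
    (trigPolySymbol (stencil (d + 1)) (pieceMatrixS (N := N)) (ofRealVec s)).det ≠ 0 := by
  rw [← fibreMatrixS_blochChar_eq_trigPolySymbol]
  exact det_fibreMatrixS_blochChar_ne_zero s

/-- Decay of the inverse kernel in the `ℓ¹` norm (rate and constant depend on `N`). [folklore] -/
theorem invKernelS_decay_l1 :
    ∃ δ M : ℝ, 0 < δ ∧ 0 ≤ M ∧ ∀ i j (x : Fin (d + 1) → ℤ),
      ‖invKernel (stencil (d + 1)) (pieceMatrixS (N := N)) x i j‖ ≤ M * Real.exp (-(δ * ∑ μ, |(x μ : ℝ)|)) :=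
  FibreInverseDecay.invKernel_decay_l1 _ _ (fun s _ => det_trigPolySymbolS_ne_zero s)

/-- The fundamental-solution identity for the scalar system. [folklore] -/
theorem fibreS_fundamental_left (x : Fin (d + 1) → ℤ) :
    ∑ a ∈ stencil (d + 1), pieceMatrixS (N := N) a * invKernel (stencil (d + 1)) (pieceMatrixS (N := N)) (x + a)
      = if x = 0 then 1 else 0 :=
  FibreInverseDecay.fundamental_left _ _ (fun s _ => det_trigPolySymbolS_ne_zero s) x

/-- THE FUNDAMENTAL CONFIGURATION with source `e`. [folklore] -/
def fundCfgS (e : IdxS (d + 1) N → ℂ) : CfgS (d + 1) N :=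
  fun q => (invKernel (stencil (d + 1)) (pieceMatrixS (N := N)) q).mulVec e

/-- **THE FUNDAMENTAL CONFIGURATION SOLVES THE BLOCK SYSTEM WITH A DELTA SOURCE.** [folklore] -/
theorem cfgFunS_fundCfgS (e : IdxS (d + 1) N → ℂ) (y : AffineAveraging.Site (d + 1)) :
    cfgFunS (shiftCfgS (fundCfgS (N := N) e) y) = if y = 0 then e else 0 := by
  rw [cfgFunS_shiftCfgS_eq_sum]
  have : ∀ a ∈ stencil (d + 1), (pieceMatrixS (N := N) a).mulVec (fundCfgS e (y + a))
      = (pieceMatrixS (N := N) a * invKernel (stencil (d + 1)) (pieceMatrixS (N := N)) (y + a)).mulVec e := by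
    intro a _
    simp only [fundCfgS]
    rw [Matrix.mulVec_mulVec]
  rw [Finset.sum_congr rfl this, ← Matrix.sum_mulVec, fibreS_fundamental_left]
  split_ifs
  · exact Matrix.one_mulVec e
  · exact Matrix.zero_mulVec e

/-- EL rows read back on `ℤ^{d+1}` for an ARBITRARY source. [folklore] -/
theorem fundCfgS_EL (e : IdxS (d + 1) N → ℂ) (x : AffineAveraging.Site (d + 1)) :
    codiff₁ (dz (cfgL (fundCfgS (N := N) e))) x - cfgW (fundCfgS (N := N) e) (quo N x)
      = if quo N x = 0 then e (Sum.inl (Torus.proj N x)) else 0 := by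
  have hx : x = repZ (Torus.proj N x) + (N : ℤ) • quo N x := eq_repZ_add_zsmul_quo x
  have h := congr_fun (cfgFunS_fundCfgS (N := N) e (quo N x)) (Sum.inl (Torus.proj N x))
  rw [cfgFunS_shiftCfgS_inl, ← hx] at h
  rw [h]
  split_ifs <;> rfl

/-- The M rows read back: block sums. [folklore] -/
theorem fundCfgS_M (e : IdxS (d + 1) N → ℂ) (y : AffineAveraging.Site (d + 1)) :
    blockSum N (cfgL (fundCfgS (N := N) e)) y = if y = 0 then e (Sum.inr ()) else 0 := by
  have h := congr_fun (cfgFunS_fundCfgS (N := N) e y) (Sum.inr ())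
  rw [cfgFunS_shiftCfgS_inr] at h
  rw [h]
  split_ifs <;> rfl

end Junction

/-! ## §7 The Green kernel with a unit force at a fine site of block `0`: identities -/

section Green

variable [NeZero N]

/-- The force source: `1` on the EL row `inl z₀`, `0` elsewhere. [folklore] -/
def srcS (z₀ : TorusSite (d + 1) N) : IdxS (d + 1) N → ℂ := fun i =>
  match i with
  | Sum.inl z => if z = z₀ then 1 else 0
  | Sum.inr _ => 0

omit [NeZero N] in
/-- EL rows of the source. [folklore] -/
@[simp] theorem srcS_inl (z₀ z : TorusSite (d + 1) N) : srcS z₀ (Sum.inl z) = if z = z₀ then 1 else 0 := rfl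

omit [NeZero N] in
/-- The M row of the source vanishes. [folklore] -/
@[simp] theorem srcS_inr (z₀ : TorusSite (d + 1) N) (u : Unit) : srcS z₀ (Sum.inr u) = 0 := rfl

/-- `K.mulVec (srcS z₀)` is the `inl z₀` column of `K`. [folklore] -/
theorem mulVec_srcS (K : Matrix (IdxS (d + 1) N) (IdxS (d + 1) N) ℂ) (z₀ : TorusSite (d + 1) N) (i : IdxS (d + 1) N) :
    K.mulVec (srcS z₀) i = K i (Sum.inl z₀) := by
  simp [Matrix.mulVec, dotProduct, srcS, Fintype.sum_sum_type]

/-- The complex fine field of the force column. [folklore] -/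
def gcolL (z₀ : TorusSite (d + 1) N) : Form0 (d + 1) ℂ := cfgL (fundCfgS (N := N) (srcS z₀))

/-- Its complex multiplier. [folklore] -/
def gcolW (z₀ : TorusSite (d + 1) N) : Form0 (d + 1) ℂ := cfgW (fundCfgS (N := N) (srcS z₀))

/-- COLUMN IDENTITY (ELₛ): `codiff₁ (dz λ) x = ω (quo N x) + δ_{x, repZ z₀}`. [folklore] -/
theorem gcolL_EL (z₀ : TorusSite (d + 1) N) (x : AffineAveraging.Site (d + 1)) :
    codiff₁ (dz (gcolL (N := N) z₀)) x = gcolW (N := N) z₀ (quo N x) + (if x = repZ z₀ then 1 else 0) := by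
  have h := fundCfgS_EL (N := N) (srcS z₀) x
  rw [srcS_inl] at h
  have hδ : (if quo N x = 0 then (if Torus.proj N x = z₀ then (1 : ℂ) else 0) else 0)
      = if x = repZ z₀ then 1 else 0 := by
    have key : x = repZ z₀ ↔ quo N x = 0 ∧ Torus.proj N x = z₀ := eq_repZ_iff (N := N) x z₀
    by_cases hq : quo N x = 0 <;> by_cases hp : Torus.proj N x = z₀ <;> simp [hq, hp, key]
  rw [hδ] at h
  simp only [gcolL, gcolW]
  linear_combination h

/-- COLUMN IDENTITY (Mₛ): the force column has ZERO block sums (a fluctuation field). [folklore] -/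
theorem gcolL_M (z₀ : TorusSite (d + 1) N) (y : AffineAveraging.Site (d + 1)) :
    blockSum N (gcolL (N := N) z₀) y = 0 := by
  have h := fundCfgS_M (N := N) (srcS z₀) y
  rw [srcS_inr] at h
  simp only [gcolL]
  rw [h]; split_ifs <;> rfl

omit [NeZero N] in
/-- `Re` commutes with `blockSum`. [folklore] -/
theorem re0_blockSum (f : Form0 (d + 1) ℂ) (y : AffineAveraging.Site (d + 1)) :
    re0 (blockSum N f) y = blockSum N (re0 f) y := by
  simp [blockSum, Complex.re_sum]

/-- THE REAL GREEN COLUMN `gS z₀ := Re λ` of the force column. [folklore] -/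
def gS (z₀ : TorusSite (d + 1) N) : Form0 (d + 1) ℝ := re0 (gcolL (N := N) z₀)

/-- Its real multiplier. [folklore] -/
def wS (z₀ : TorusSite (d + 1) N) : Form0 (d + 1) ℝ := re0 (gcolW (N := N) z₀)

/-- (ELₛ) for the real column: `codiff₁ (dz (gS z₀)) x = wS z₀ (quo N x) + δ_{x, repZ z₀}`. [folklore] -/
theorem gS_EL (z₀ : TorusSite (d + 1) N) (x : AffineAveraging.Site (d + 1)) :
    codiff₁ (dz (gS (N := N) z₀)) x = wS (N := N) z₀ (quo N x) + (if x = repZ z₀ then 1 else 0) := by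
  have h := congrArg Complex.re (gcolL_EL (N := N) z₀ x)
  have h1 : (codiff₁ (dz (gcolL (N := N) z₀)) x).re = codiff₁ (dz (gS (N := N) z₀)) x := by
    have := congr_fun (re0_codiff₁ (dz (gcolL (N := N) z₀))) x
    rw [re0_apply] at this
    rw [this, re1_dz]; rfl
  rw [h1, Complex.add_re] at h
  rw [h]
  simp only [wS, re0_apply]
  split_ifs <;> simp

/-- (Mₛ) for the real column: zero block sums. [folklore] -/
theorem gS_M (z₀ : TorusSite (d + 1) N) (y : AffineAveraging.Site (d + 1)) : blockSum N (gS (N := N) z₀) y = 0 := by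
  have h := congrArg Complex.re (gcolL_M (N := N) z₀ y)
  rw [Complex.zero_re] at h
  rw [gS, ← re0_blockSum, re0_apply]
  exact h

end Green

/-! ## §8 Decay at fixed `N` -/

section Decay

variable [NeZero N]

/-- Decay of the force columns in the block index, uniformly in the source, AT FIXED `N`. [folklore] -/
theorem fundCfgS_srcS_decay :
    ∃ δ M : ℝ, 0 < δ ∧ 0 ≤ M ∧ ∀ (z₀ : TorusSite (d + 1) N) (q : AffineAveraging.Site (d + 1)) (i : IdxS (d + 1) N),
      ‖fundCfgS (N := N) (srcS z₀) q i‖ ≤ M * Real.exp (-(δ * l1 q)) := by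
  obtain ⟨δ, M, hδ, hM, h⟩ := invKernelS_decay_l1 (N := N) (d := d)
  refine ⟨δ, M, hδ, hM, fun z₀ q i => ?_⟩
  simp only [fundCfgS, mulVec_srcS]
  exact h i _ q

/-- **DECAY OF THE GREEN COLUMN** from the origin (`Decay510` shape), uniformly in the source, AT FIXED `N`: witnesses
`δ_N = δ / N`, `C_N = M e^{δ(d+1)}`; no uniformity in `N` claimed. [folklore] -/
theorem decay_gS : ∃ δ C : ℝ, 0 < δ ∧ 0 ≤ C ∧ ∀ (z₀ : TorusSite (d + 1) N), Decay510 (gS (N := N) z₀) C δ := by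
  obtain ⟨δ, M, hδ, hM, h⟩ := fundCfgS_srcS_decay (N := N) (d := d)
  have hN : (0 : ℝ) < N := by exact_mod_cast Nat.pos_of_ne_zero (NeZero.ne N)
  refine ⟨δ / N, M * Real.exp (δ * (d + 1)), div_pos hδ hN, by positivity, fun z₀ z => ?_⟩
  calc |gS (N := N) z₀ z| ≤ ‖gcolL (N := N) z₀ z‖ := Complex.abs_re_le_norm _
    _ = ‖fundCfgS (N := N) (srcS z₀) (quo N z) (Sum.inl (Torus.proj N z))‖ := rfl
    _ ≤ M * Real.exp (-(δ * l1 (quo N z))) := h z₀ _ _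
    _ ≤ M * (Real.exp (δ * (d + 1)) * Real.exp (-(δ / N) * l1 z)) :=
        mul_le_mul_of_nonneg_left (exp_quo_le (N := N) hδ z) hM
    _ = M * Real.exp (δ * (d + 1)) * Real.exp (-(δ / N) * l1 z) := by ring

/-- **DECAY OF THE MULTIPLIER COLUMN** (a coarse field: decay in the block index), AT FIXED `N`. [folklore] -/
theorem decay_wS : ∃ δ C : ℝ, 0 < δ ∧ 0 ≤ C ∧ ∀ (z₀ : TorusSite (d + 1) N), Decay510 (wS (N := N) z₀) C δ := by
  obtain ⟨δ, M, hδ, hM, h⟩ := fundCfgS_srcS_decay (N := N) (d := d)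
  refine ⟨δ, M, hδ, hM, fun z₀ y => ?_⟩
  calc |wS (N := N) z₀ y| ≤ ‖gcolW (N := N) z₀ y‖ := Complex.abs_re_le_norm _
    _ = ‖fundCfgS (N := N) (srcS z₀) y (Sum.inr ())‖ := rfl
    _ ≤ M * Real.exp (-(δ * l1 y)) := h z₀ _ _
    _ = M * Real.exp (-δ * l1 y) := by rw [neg_mul]

end Decay

/-! ## §9 Arbitrary source site by block translation (taken as the definition) -/

section Translate2

variable [NeZero N]

/-- THE GREEN KERNEL `Gs x x'`: the field at `x` of the solution with a unit force at the fine site `x'`, defined from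
the block-`0` columns by block translation. [folklore] -/
def Gs (x x' : AffineAveraging.Site (d + 1)) : ℝ := gS (N := N) (Torus.proj N x') (x - (N : ℤ) • quo N x')

/-- Its coarse multiplier `Ws y x'`. [folklore] -/
def Ws (y x' : AffineAveraging.Site (d + 1)) : ℝ := wS (N := N) (Torus.proj N x') (y - quo N x')

/-- `codiff₁ ∘ dz` of a fine translate. [folklore] -/
theorem lapN_shiftS (f : Form0 (d + 1) ℝ) (w x : AffineAveraging.Site (d + 1)) :
    codiff₁ (dz (fun x => f (x - w))) x = codiff₁ (dz f) (x - w) := by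
  simp only [codiff₁, dz]
  refine Finset.sum_congr rfl (fun κ _ => ?_)
  rw [show x - unitVec κ + unitVec κ - w = x - w - unitVec κ + unitVec κ by abel,
    show x - unitVec κ - w = x - w - unitVec κ by abel,
    show x + unitVec κ - w = x - w + unitVec κ by abel]

/-- (ELₛ) for the Green kernel: `codiff₁ (dz (Gs · x')) x = Ws (quo N x) x' + δ_{x x'}`. [folklore] -/
theorem Gs_EL (x' x : AffineAveraging.Site (d + 1)) :
    codiff₁ (dz (fun z => Gs (N := N) z x')) x = Ws (N := N) (quo N x) x' + (if x = x' then 1 else 0) := by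
  have h := gS_EL (N := N) (Torus.proj N x') (x - (N : ℤ) • quo N x')
  have hq : quo N (x - (N : ℤ) • quo N x') = quo N x - quo N x' := by
    rw [sub_eq_add_neg, ← smul_neg, quo_add_zsmul, ← sub_eq_add_neg]
  have e4 : (x - (N : ℤ) • quo N x' = repZ (Torus.proj N x')) ↔ x = x' := by
    rw [sub_eq_iff_eq_add, ← eq_repZ_add_zsmul_quo (N := N) x']
  have e1 : codiff₁ (dz (fun z => Gs (N := N) z x')) x
      = codiff₁ (dz (gS (N := N) (Torus.proj N x'))) (x - (N : ℤ) • quo N x') := by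
    simp only [Gs]; exact lapN_shiftS _ _ x
  rw [e1, h, hq]
  simp only [Ws, e4]

/-- (Mₛ) for the Green kernel: zero block sums in the field variable. [folklore] -/
theorem Gs_M (x' y : AffineAveraging.Site (d + 1)) : blockSum N (fun z => Gs (N := N) z x') y = 0 := by
  simp only [Gs]
  rw [blockSum_shift, gS_M]

/-- **DECAY OF THE GREEN KERNEL** in `|x − x'|₁`, AT FIXED `N`. [folklore] -/
theorem decay_Gs : ∃ δ C : ℝ, 0 < δ ∧ 0 ≤ C ∧ ∀ (x x' : AffineAveraging.Site (d + 1)),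
    |Gs (N := N) x x'| ≤ C * Real.exp (-δ * l1 (x - x')) := by
  obtain ⟨δ, C, hδ, hC, h⟩ := decay_gS (N := N) (d := d)
  refine ⟨δ, C * Real.exp (δ * ((N : ℝ) * (d + 1))), hδ, by positivity, fun x x' => ?_⟩
  have hx' : x' = repZ (Torus.proj N x') + (N : ℤ) • quo N x' := eq_repZ_add_zsmul_quo x'
  have hsplit : x - x' = (x - (N : ℤ) • quo N x') - repZ (Torus.proj N x') := by
    conv_lhs => rw [hx']
    abel
  have hl1 : l1 (x - x') ≤ l1 (x - (N : ℤ) • quo N x') + (N : ℝ) * (d + 1) := by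
    rw [hsplit]
    exact (l1_sub_le _ _).trans (by linarith [l1_repZ_le (N := N) (Torus.proj N x')])
  have hdec := h (Torus.proj N x') (x - (N : ℤ) • quo N x')
  calc |Gs (N := N) x x'| = |gS (N := N) (Torus.proj N x') (x - (N : ℤ) • quo N x')| := rfl
    _ ≤ C * Real.exp (-δ * l1 (x - (N : ℤ) • quo N x')) := hdec
    _ ≤ C * (Real.exp (δ * ((N : ℝ) * (d + 1))) * Real.exp (-δ * l1 (x - x'))) := by
        refine mul_le_mul_of_nonneg_left ?_ hC
        rw [← Real.exp_add]
        exact Real.exp_le_exp.2 (by nlinarith)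
    _ = C * Real.exp (δ * ((N : ℝ) * (d + 1))) * Real.exp (-δ * l1 (x - x')) := by ring

end Translate2

end

end Literature.MathematicalPhysics.QuantumFieldTheory.Balaban1983to89.Beta.ScalarBlockKKT
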